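import Literature.AnabelianGeometry.EtaleTheta.Discharge.Sec5OfThetaSetting
import Literature.AnabelianGeometry.EtaleTheta.Discharge.Sec5EnvelopeTopology
import Literature.AlgebraicGeometry.Frobenioids.ModelFrobenioidAutAction

/-!
# [EtTh] Lemma 5.8 proof p. 331 (PDF p. 105): F-1306 `CyclotomicCharacterCompatX` at the assembled §5 data IS a statement about the
# rational-function functor `B` of the tempered Frobenioid — no bi-Kummer section enters (PROOF-ONLY)

Mochizuki, *The étale theta function and its Frobenioid-theoretic manifestations*, Publ. RIMS **45** (2009)
[cite: MochizukiEtTh2009, Lem 5.8 proof p.331 (PDF p.105); Def 3.6 (ii) p.304 (PDF p.78)]; Mochizuki, *The geometry of Frobenioids I*,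
Kyushu J. Math. **62** (2008), Thm. 5.2 (i)/(ii) p. 100–101 [cite: MochizukiFrdI2008, Thm. 5.2 (i) p.100].
abc-iut cell, layer L2, sequel (J3) of row R212 of abc-iut-L2-lead (gen 3) «F-1306 at the junction `ofThetaSettingData`»; seat
abc-iut-f-125 (gen 2).  PROOF-ONLY (no `def`, no instance, no new `Prop` fact; nothing landed is edited or restated).

THE POINT.  The FACT-LIST row F-1306 `ThetaFrobenioid.CyclotomicCharacterCompatX T ι m` (abc-iut-L2-t11, `Sec5EnvelopeTopology.lean`)
reads: for `g ∈ Π^tp_X̲`, CONJUGATION BY THE BI-KUMMER SECTION VALUE `s^⊓-gp_N(ρ g) ∈ Aut_C(B_N)` on `μ_N(B_N) ⊆ O^×(B_N)` is, under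
`m : μ_N(B_N) ≃ μ_N`, the cyclotomic character `χ(aug(ι g))`.  For every §5 datum ASSEMBLED over abc-iut-L2-t3's §4 setting
(`ofBiKummerData`, whose Frobenioid is the MODEL Frobenioid of the tempered Frobenioid `tf`, [FrdI] Thm. 5.2) the section disappears:
conjugating a unit `u ∈ O^×(B_N)` by ANY `e ∈ Aut_C(B_N)` replaces its rational function `u_u ∈ B(B_N^bs)^×` by the pull-back
`B(Base(e)⁻¹)(u_u)` ([FrdI] Thm. 5.2 (i) unit calculus, abc-iut-L2-t4's `unit_conj_of_mem_units`), a unit is determined by its rational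
function (`ModelFrobenioid.aut_eq_of_baseMap_eq_of_unit_eq`, `Φ` divisorial), and `Base(s^⊓-gp_N(ρ g)) = ρ g` (`SgpCapSection`).  Hence
(`cyclotomicCharacterCompatX_ofBiKummerData_iff_ratFn`):

  F-1306 ⟺ for all `g ∈ Π^tp_X̲` and all `N`-torsion units `u, u'` of `B_N`:
           `u_{u'} = B((ρ g)⁻¹)(u_u)  ⟹  m u' = χ(aug(ι g)) (m u)`,

a clause about the functor `B = tf.ratFnFunctor` ("the rational functions", Def. 3.6 (ii)) at the Galois object `B_N^bs`, the Galois
action `ρ : Π^tp_X̲ → Aut_D(B_N^bs)` and `m` ONLY — print's "`Π^tp_Y` [i.e., `G_K`, via the natural surjection `Π^tp_Y ↠ G_K`] acts [on the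
constants] via multiplication by an element of `μ_N(B_N)`" read on the data that DEFINE the tempered Frobenioid, which is where an
«origin clause» for the abstract parameter `tf` belongs (abc-iut-L2-t3's v-next census).  At abc-iut-L2-t4's junction
`ofThetaSettingData` (p433549: `X := Π^tp_X̲̲`, `T := C.thetaEnvData μ hC hS`, `ι := id`, `σ = s^trv_N` constructed so `SgpCapSection` is a
theorem) this gives `cyclotomicCharacterCompatX_ofThetaSettingData_iff_ratFn` with NO hypothesis besides the data.
HONEST FRAMING: kernel-checked bookkeeping over the typed interfaces; `tf` stays an abstract parameter (not inhabited for the curve);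
nothing of [EtTh] is asserted; a FACT row is an assumption label; no side is taken on [IUTchIII] Cor. 3.12; typed ≠ proved.
-/

noncomputable section

namespace Literature.AnabelianGeometry.EtaleTheta

open CategoryTheory Opposite Literature.AlgebraicGeometry.Frobenioids Literature.AnabelianGeometry.SemiGraphs
  Literature.AnabelianGeometry.SemiGraphs.GaloisObjects Literature.AlgebraicGeometry.Frobenioids.QuasiTemperoid.BTempConnected

universe u₀ v₀ u v w

namespace ThetaFrobenioid

/-! ### The unit calculus of the assembled §5 data: conjugation = pull-back of the rational function -/

section OfBiKummerData

variable {K : Type u₀} [Field K] {X : SemiGraphs.TemperedArithmeticGroup.{u₀} K} {D₀ : Type u₀} [Category.{v₀} D₀]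
  {V : FrdIMonoidStub.{w}} {T₀ : RealifiedDivisorMonoids (D₀ := D₀) V} {D : Type u} [Category.{v} D]
  {VD : FrdICatStub.{u, v, w} D} {S : BiKummerSetting X T₀ D VD}
  {pullFrac : ∀ {A A' : S.C} (_ : A' ⟶ A), S.biratUnits A → S.biratUnits A'}
  {lv N : ℕ+} {T : ThetaEnvData.{max v w} N} {θ : S.biratUnits S.Aodot} {Bl : S.C}
  {Pl : S.FractionPair θ Bl} {Rl : S.NthRoot θ Pl lv pullFrac}
  (h : ModelFrobenioid.Hypotheses S.tf.divisorMonoid S.tf.ratFnFunctor)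
  (toB : ∀ A : S.C, S.biratUnits A →* S.tf.biratUnitsModel A) (Q : FrobenioidTheta.ThetaSubquotientStub.{w} D)
  (odd_l : Odd (lv : ℕ)) (R : S.NthRoot Rl.root Rl.pair N pullFrac) (ιX : T.PiX ≃ₜ* X.Pi)
  (hopen : IsOpen ((S.galoisSurj R.AN.base R.αData.isGalois).ker : Set X.Pi)) (σ : Aut R.AN.base →* Aut R.AN)
  (K' : Type w) [Field K'] (constEmb : K'ˣ →* S.tf.biratUnitsModel R.BN)
  (constEmb_injective : Function.Injective constEmb)
  (hdivc : ∀ g : Aut R.BN.base,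
    ModelFrobenioid.div ((σ ((BiKummerSetting.NthRoot.baseIso S R).conjAut.symm g)).hom ≫ R.pair.num) =
      ModelFrobenioid.div R.pair.num)
  (hdivp : ∀ y : T.PiYdd,
    ModelFrobenioid.div ((σ (S.galoisSurj R.AN.base R.αData.isGalois (ιX y.1))).hom ≫ R.pair.den) =
      ModelFrobenioid.div R.pair.den)

/-- **Conjugating a unit of `B_N` pulls its rational function back** ([FrdI] Thm. 5.2 (i)): for the assembled §5 data, `u ∈ O^×(B_N)`
and ANY `e ∈ Aut_C(B_N)`, the rational function of `e ∘ u ∘ e⁻¹` is `B(Base(e⁻¹))(u_u)` (abc-iut-L2-t4's `unit_conj_of_mem_units`, read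
on `ofBiKummerData`, whose Frobenioid is the model Frobenioid of `S.tf`).  [cite: MochizukiFrdI2008, Thm. 5.2 (i) p.100] -/
theorem unit_conj_ofBiKummerData (e : Aut (ofBiKummerData h toB Q odd_l R ιX hopen σ K' constEmb constEmb_injective hdivc hdivp).BN)
    (u : (ofBiKummerData h toB Q odd_l R ιX hopen σ K' constEmb constEmb_injective hdivc hdivp).units
      (ofBiKummerData h toB Q odd_l R ιX hopen σ K' constEmb constEmb_injective hdivc hdivp).BN) :
    ModelFrobenioid.unit (e * u.1 * e⁻¹).hom =
      pull S.tf.ratFnFunctor (ModelFrobenioid.baseMap e.inv) (ModelFrobenioid.unit u.1.hom) :=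
  unit_conj_of_mem_units e u.1 u.2

/-- **A unit of `B_N` is determined by its rational function** (`Φ` divisorial, [FrdI] Thm. 5.2 (i): `α ↦ (Base α, u_α)` is injective
and `Base` of a unit is the identity).  [cite: MochizukiFrdI2008, Thm. 5.2 (i) p.100] -/
theorem units_eq_of_unit_eq_ofBiKummerData
    {u u' : Aut (ofBiKummerData h toB Q odd_l R ιX hopen σ K' constEmb constEmb_injective hdivc hdivp).BN}
    (hu : u ∈ (ofBiKummerData h toB Q odd_l R ιX hopen σ K' constEmb constEmb_injective hdivc hdivp).units
      (ofBiKummerData h toB Q odd_l R ιX hopen σ K' constEmb constEmb_injective hdivc hdivp).BN)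
    (hu' : u' ∈ (ofBiKummerData h toB Q odd_l R ιX hopen σ K' constEmb constEmb_injective hdivc hdivp).units
      (ofBiKummerData h toB Q odd_l R ιX hopen σ K' constEmb constEmb_injective hdivc hdivp).BN)
    (heq : ModelFrobenioid.unit u.hom = ModelFrobenioid.unit u'.hom) : u = u' :=
  ModelFrobenioid.aut_eq_of_baseMap_eq_of_unit_eq (fun A => h.isDivisorial A) (hu.1.trans hu'.1.symm) heq

/-- **`u' = e ∘ u ∘ e⁻¹` iff `u_{u'} = B(Base(e⁻¹))(u_u)`** for units `u, u'` of `B_N` and any `e ∈ Aut_C(B_N)`.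
[cite: MochizukiFrdI2008, Thm. 5.2 (i) p.100] -/
theorem eq_conj_iff_unit_eq_pull_ofBiKummerData
    (e : Aut (ofBiKummerData h toB Q odd_l R ιX hopen σ K' constEmb constEmb_injective hdivc hdivp).BN)
    (u u' : (ofBiKummerData h toB Q odd_l R ιX hopen σ K' constEmb constEmb_injective hdivc hdivp).units
      (ofBiKummerData h toB Q odd_l R ιX hopen σ K' constEmb constEmb_injective hdivc hdivp).BN) :
    u'.1 = e * u.1 * e⁻¹ ↔
      ModelFrobenioid.unit u'.1.hom =
        pull S.tf.ratFnFunctor (ModelFrobenioid.baseMap e.inv) (ModelFrobenioid.unit u.1.hom) := by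
  constructor
  · intro heq
    rw [heq]
    exact unit_conj_ofBiKummerData h toB Q odd_l R ιX hopen σ K' constEmb constEmb_injective hdivc hdivp e u
  · intro heq
    have hcu : e * u.1 * e⁻¹ ∈
        (ofBiKummerData h toB Q odd_l R ιX hopen σ K' constEmb constEmb_injective hdivc hdivp).units
          (ofBiKummerData h toB Q odd_l R ιX hopen σ K' constEmb constEmb_injective hdivc hdivp).BN :=
      ((ofBiKummerData h toB Q odd_l R ιX hopen σ K' constEmb constEmb_injective hdivc hdivp).units_normal _).conj_mem _ u.2 e
    exact units_eq_of_unit_eq_ofBiKummerData h toB Q odd_l R ιX hopen σ K' constEmb constEmb_injective hdivc hdivp u'.2 hcu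
      (heq.trans (unit_conj_ofBiKummerData h toB Q odd_l R ιX hopen σ K' constEmb constEmb_injective hdivc hdivp e u).symm)

/-- **`Base(s^⊓-gp_N(x))⁻¹ = x⁻¹`** under the section property `SgpCapSection` ("`(s^⊓-gp_N(g))^bs = g`", §5 p.331).
[cite: MochizukiEtTh2009, §5 p.331 (PDF p.105)] -/
theorem baseMap_sgpCap_inv_of_sgpCapSection
    (hsec : (ofBiKummerData h toB Q odd_l R ιX hopen σ K' constEmb constEmb_injective hdivc hdivp).SgpCapSection)
    (x : Aut ((ofBiKummerData h toB Q odd_l R ιX hopen σ K' constEmb constEmb_injective hdivc hdivp).base.obj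
      (ofBiKummerData h toB Q odd_l R ιX hopen σ K' constEmb constEmb_injective hdivc hdivp).BN)) :
    ModelFrobenioid.baseMap ((ofBiKummerData h toB Q odd_l R ιX hopen σ K' constEmb constEmb_injective hdivc hdivp).sgpCap x).inv =
      x.inv :=
  congrArg Iso.inv (hsec x)

/-- **F-1306 in rational-function form for every assembled §5 datum** (under `SgpCapSection`): `CyclotomicCharacterCompatX T ι m` holds iff
for all `g ∈ Π^tp_X̲` and all `u, u' ∈ μ_N(B_N)` with `u_{u'} = B((ρ g)⁻¹)(u_u)` one has `m u' = χ(aug(ι g)) (m u)` — no bi-Kummer section in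
the clause.  [cite: MochizukiEtTh2009, Lem 5.8 proof p.331 (PDF p.105)] [cite: MochizukiFrdI2008, Thm. 5.2 (i) p.100] -/
theorem cyclotomicCharacterCompatX_ofBiKummerData_iff_ratFn
    (hsec : (ofBiKummerData h toB Q odd_l R ιX hopen σ K' constEmb constEmb_injective hdivc hdivp).SgpCapSection)
    (T' : ThetaEnvData.{max v w} N) (ι : T.PiX ≃* T'.PiX)
    (m : (ofBiKummerData h toB Q odd_l R ιX hopen σ K' constEmb constEmb_injective hdivc hdivp).muTorsion
        (ofBiKummerData h toB Q odd_l R ιX hopen σ K' constEmb constEmb_injective hdivc hdivp).BN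
        (ofBiKummerData h toB Q odd_l R ιX hopen σ K' constEmb constEmb_injective hdivc hdivp).N ≃* T'.mu) :
    (ofBiKummerData h toB Q odd_l R ιX hopen σ K' constEmb constEmb_injective hdivc hdivp).CyclotomicCharacterCompatX T' ι m ↔
      ∀ (g : T.PiX)
        (u u' : (ofBiKummerData h toB Q odd_l R ιX hopen σ K' constEmb constEmb_injective hdivc hdivp).muTorsion
          (ofBiKummerData h toB Q odd_l R ιX hopen σ K' constEmb constEmb_injective hdivc hdivp).BN
          (ofBiKummerData h toB Q odd_l R ιX hopen σ K' constEmb constEmb_injective hdivc hdivp).N),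
        ModelFrobenioid.unit u'.1.hom =
            pull S.tf.ratFnFunctor (rhoOfBiKummerData R ιX g).inv (ModelFrobenioid.unit u.1.hom) →
          m u' = T'.chi (T'.aug (ι g)) (m u) := by
  refine forall_congr' fun g => forall_congr' fun u => forall_congr' fun u' => ?_
  have key := eq_conj_iff_unit_eq_pull_ofBiKummerData h toB Q odd_l R ιX hopen σ K' constEmb constEmb_injective hdivc hdivp
    ((ofBiKummerData h toB Q odd_l R ιX hopen σ K' constEmb constEmb_injective hdivc hdivp).sgpCap
      ((ofBiKummerData h toB Q odd_l R ιX hopen σ K' constEmb constEmb_injective hdivc hdivp).ρ g))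
    ⟨u.1, u.2.1⟩ ⟨u'.1, u'.2.1⟩
  rw [baseMap_sgpCap_inv_of_sgpCapSection h toB Q odd_l R ιX hopen σ K' constEmb constEmb_injective hdivc hdivp hsec] at key
  exact imp_congr key Iff.rfl

end OfBiKummerData

/-! ### Over the genuine connected base `B^temp(Π^tp_X)⁰` (`ofConnectedTemperoidData`): no hypothesis -/

section Connected

variable {K : Type u₀} [Field K] {X : SemiGraphs.TemperedArithmeticGroup.{u₀} K} {D₀ : Type u₀} [Category.{v₀} D₀]
  {V : FrdIMonoidStub.{w}} {T₀ : RealifiedDivisorMonoids (D₀ := D₀) V}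
  {VD : FrdICatStub.{u₀ + 1, u₀, w} (ConnectedPart (BTemp X.Pi))}
  {tf : TemperedFrobenioid T₀ (ConnectedPart (BTemp X.Pi)) VD} {hZ : tf.monoidType = MonoidType.Z}
  {hP : ∀ A : (ConnectedPart (BTemp X.Pi))ᵒᵖ, IsPerfect (tf.Φ.carrier A)}
  {NH : Subgroup (Field.absoluteGaloisGroup K) → tf.category → ℕ+ → Prop} {A₀ : tf.category}
  {hA₀ : PreFrobenioid.IsFrobeniusTrivial tf.toElem A₀} {hA₀' : SemiGraphs.IsGaloisObj A₀.base.obj}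
  {pullFrac : ∀ {A A' : (BiKummerSetting.mkOfConnectedTemperoid X tf hZ hP NH A₀ hA₀ hA₀').C} (_ : A' ⟶ A),
    (BiKummerSetting.mkOfConnectedTemperoid X tf hZ hP NH A₀ hA₀ hA₀').biratUnits A →
      (BiKummerSetting.mkOfConnectedTemperoid X tf hZ hP NH A₀ hA₀ hA₀').biratUnits A'}
  {lv N : ℕ+} {T : ThetaEnvData.{max u₀ w} N}
  {θ : (BiKummerSetting.mkOfConnectedTemperoid X tf hZ hP NH A₀ hA₀ hA₀').biratUnits
    (BiKummerSetting.mkOfConnectedTemperoid X tf hZ hP NH A₀ hA₀ hA₀').Aodot}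
  {Bl : (BiKummerSetting.mkOfConnectedTemperoid X tf hZ hP NH A₀ hA₀ hA₀').C}
  {Pl : (BiKummerSetting.mkOfConnectedTemperoid X tf hZ hP NH A₀ hA₀ hA₀').FractionPair θ Bl}
  {Rl : (BiKummerSetting.mkOfConnectedTemperoid X tf hZ hP NH A₀ hA₀ hA₀').NthRoot θ Pl lv pullFrac}
  (h : ModelFrobenioid.Hypotheses tf.divisorMonoid tf.ratFnFunctor)
  (Q : FrobenioidTheta.ThetaSubquotientStub.{w} (ConnectedPart (BTemp X.Pi))) (odd_l : Odd (lv : ℕ))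
  (R : (BiKummerSetting.mkOfConnectedTemperoid X tf hZ hP NH A₀ hA₀ hA₀').NthRoot Rl.root Rl.pair N pullFrac)
  (ιX : T.PiX ≃ₜ* X.Pi) (K' : Type w) [Field K'] (constEmb : K'ˣ →* tf.biratUnitsModel R.BN)
  (constEmb_injective : Function.Injective constEmb)
  (hinvc : ∀ g : Aut R.AN.base,
    pull tf.divisorMonoid g.hom (ModelFrobenioid.div R.pair.num) = ModelFrobenioid.div R.pair.num)
  (hinvp : ∀ y : T.PiX, y ∈ T.PiYdd →
    pull tf.divisorMonoid ((BiKummerSetting.mkOfConnectedTemperoid X tf hZ hP NH A₀ hA₀ hA₀').galoisSurj R.AN.base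
      R.αData.isGalois (ιX y)).hom (ModelFrobenioid.div R.pair.den) = ModelFrobenioid.div R.pair.den)

/-- **F-1306 in rational-function form over `B^temp(Π^tp_X)⁰`, NO hypothesis** (`SgpCapSection` is abc-iut-L2-t4's theorem
`sgpCapSection_ofConnectedTemperoidData`, `σ = s^trv_N` being constructed): `CyclotomicCharacterCompatX T' ι m` holds iff for all `g ∈ Π^tp_X̲`
and all `N`-torsion units `u, u'` of `B_N`, `u_{u'} = B((ρ_N g)⁻¹)(u_u) ⟹ m u' = χ(aug(ι g))(m u)`, `B = tf.ratFnFunctor`.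
[cite: MochizukiEtTh2009, Lem 5.8 proof p.331 (PDF p.105)] [cite: MochizukiFrdI2008, Thm. 5.2 (i) p.100] -/
theorem cyclotomicCharacterCompatX_ofConnectedTemperoidData_iff_ratFn (T' : ThetaEnvData.{max u₀ w} N) (ι : T.PiX ≃* T'.PiX)
    (m : (ofConnectedTemperoidData h Q odd_l R ιX K' constEmb constEmb_injective hinvc hinvp).muTorsion
        (ofConnectedTemperoidData h Q odd_l R ιX K' constEmb constEmb_injective hinvc hinvp).BN
        (ofConnectedTemperoidData h Q odd_l R ιX K' constEmb constEmb_injective hinvc hinvp).N ≃* T'.mu) :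
    (ofConnectedTemperoidData h Q odd_l R ιX K' constEmb constEmb_injective hinvc hinvp).CyclotomicCharacterCompatX T' ι m ↔
      ∀ (g : T.PiX)
        (u u' : (ofConnectedTemperoidData h Q odd_l R ιX K' constEmb constEmb_injective hinvc hinvp).muTorsion
          (ofConnectedTemperoidData h Q odd_l R ιX K' constEmb constEmb_injective hinvc hinvp).BN
          (ofConnectedTemperoidData h Q odd_l R ιX K' constEmb constEmb_injective hinvc hinvp).N),
        ModelFrobenioid.unit u'.1.hom =
            pull tf.ratFnFunctor ((ofConnectedTemperoidData h Q odd_l R ιX K' constEmb constEmb_injective hinvc hinvp).ρ g).inv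
              (ModelFrobenioid.unit u.1.hom) →
          m u' = T'.chi (T'.aug (ι g)) (m u) :=
  cyclotomicCharacterCompatX_ofBiKummerData_iff_ratFn h _ Q odd_l R ιX _ _ K' constEmb constEmb_injective _ _
    (sgpCapSection_ofConnectedTemperoidData h Q odd_l R ιX K' constEmb constEmb_injective hinvc hinvp) T' ι m

end Connected

/-! ### At the junction `ofThetaSettingData`: F-1306 in rational-function form, no hypothesis -/

section Junction

variable {p : ℕ} [Fact p.Prime] {D : ThetaSetting p} {E : D.EtaleThetaData} {l : ℕ} {C : E.DoubleUnderline l}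
  {e : D.toTemperedCurve.GroupLevelData} {N : ℕ+} (μ : D.CyclotomeMod l N) (hC : D.Compat) (hS : D.Sec2Hyps)
  {D₀ : Type} [Category.{v₀} D₀] {V : FrdIMonoidStub.{0}} {T₀ : RealifiedDivisorMonoids (D₀ := D₀) V}
  {VD : FrdICatStub.{1, 0, 0} (ConnectedPart (BTemp (C.temperedArithmeticGroup e).Pi))}
  {tf : TemperedFrobenioid T₀ (ConnectedPart (BTemp (C.temperedArithmeticGroup e).Pi)) VD} {hZ : tf.monoidType = MonoidType.Z}
  {hP : ∀ A : (ConnectedPart (BTemp (C.temperedArithmeticGroup e).Pi))ᵒᵖ, IsPerfect (tf.Φ.carrier A)}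
  {NH : Subgroup (Field.absoluteGaloisGroup D.K) → tf.category → ℕ+ → Prop} {A₀ : tf.category}
  {hA₀ : PreFrobenioid.IsFrobeniusTrivial tf.toElem A₀} {hA₀' : SemiGraphs.IsGaloisObj A₀.base.obj}
  {pullFrac : ∀ {A A' : (BiKummerSetting.mkOfConnectedTemperoid (C.temperedArithmeticGroup e) tf hZ hP NH A₀ hA₀ hA₀').C} (_ : A' ⟶ A),
    (BiKummerSetting.mkOfConnectedTemperoid (C.temperedArithmeticGroup e) tf hZ hP NH A₀ hA₀ hA₀').biratUnits A →
      (BiKummerSetting.mkOfConnectedTemperoid (C.temperedArithmeticGroup e) tf hZ hP NH A₀ hA₀ hA₀').biratUnits A'}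
  {θ : (BiKummerSetting.mkOfConnectedTemperoid (C.temperedArithmeticGroup e) tf hZ hP NH A₀ hA₀ hA₀').biratUnits
    (BiKummerSetting.mkOfConnectedTemperoid (C.temperedArithmeticGroup e) tf hZ hP NH A₀ hA₀ hA₀').Aodot}
  {Bl : (BiKummerSetting.mkOfConnectedTemperoid (C.temperedArithmeticGroup e) tf hZ hP NH A₀ hA₀ hA₀').C}
  {Pl : (BiKummerSetting.mkOfConnectedTemperoid (C.temperedArithmeticGroup e) tf hZ hP NH A₀ hA₀ hA₀').FractionPair θ Bl}
  {Rl : (BiKummerSetting.mkOfConnectedTemperoid (C.temperedArithmeticGroup e) tf hZ hP NH A₀ hA₀ hA₀').NthRoot θ Pl C.lPNat pullFrac}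
  (h : ModelFrobenioid.Hypotheses tf.divisorMonoid tf.ratFnFunctor)
  (Q : FrobenioidTheta.ThetaSubquotientStub.{0} (ConnectedPart (BTemp (C.temperedArithmeticGroup e).Pi)))
  (R : (BiKummerSetting.mkOfConnectedTemperoid (C.temperedArithmeticGroup e) tf hZ hP NH A₀ hA₀ hA₀').NthRoot Rl.root Rl.pair N pullFrac)
  (K' : Type) [Field K'] (constEmb : K'ˣ →* tf.biratUnitsModel R.BN) (constEmb_injective : Function.Injective constEmb)
  (hinvc : ∀ g : Aut R.AN.base,
    pull tf.divisorMonoid g.hom (ModelFrobenioid.div R.pair.num) = ModelFrobenioid.div R.pair.num)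
  (hinvp : ∀ y : (C.thetaEnvData μ hC hS).PiX, y ∈ (C.thetaEnvData μ hC hS).PiYdd →
    pull tf.divisorMonoid ((BiKummerSetting.mkOfConnectedTemperoid (C.temperedArithmeticGroup e) tf hZ hP NH A₀ hA₀ hA₀').galoisSurj
      R.AN.base R.αData.isGalois ((ContinuousMulEquiv.refl _) y)).hom (ModelFrobenioid.div R.pair.den) = ModelFrobenioid.div R.pair.den)

/-- **F-1306 AT THE JUNCTION in rational-function form, NO hypothesis** (the section property `SgpCapSection` is abc-iut-L2-t4's theorem
`sgpCapSection_ofConnectedTemperoidData`, `σ = s^trv_N` being constructed): for the §5 data of the Setting, `CyclotomicCharacterCompatX`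
with respect to the Setting's `(Π^tp_X̲̲, G_K, μ_N(ℚ̄_p), χ)` and `m : μ_N(B_N) ≃ μ_N(ℚ̄_p)` holds iff for all `g ∈ Π^tp_X̲̲` and all `N`-torsion units
`u, u'` of `B_N`, `u_{u'} = B((ρ_N g)⁻¹)(u_u) ⟹ m u' = χ(aug g)(m u)` — where `B = tf.ratFnFunctor` is the rational-function functor of the
(abstract) tempered Frobenioid and `ρ_N : Π^tp_X̲̲ ↠ Aut_D(B_N^bs)` the Setting's Galois surjection at `A_N^bs` conjugated by `(s^⊓_N)^bs`
(`rhoOfBiKummerData`): the ORIGIN CLAUSE for `tf` that F-1306 IS at the junction ("`Π^tp_Y` [i.e., `G_K` …] acts … via multiplication by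
an element of `μ_N(B_N)`", Lemma 5.8 proof, read on Def. 3.6 (ii)'s rational functions).
[cite: MochizukiEtTh2009, Lem 5.8 proof p.331 (PDF p.105); Def 3.6 (ii) p.304 (PDF p.78)] [cite: MochizukiFrdI2008, Thm. 5.2 (i) p.100] -/
theorem cyclotomicCharacterCompatX_ofThetaSettingData_iff_ratFn
    (m : (ofThetaSettingData μ hC hS h Q R K' constEmb constEmb_injective hinvc hinvp).muTorsion
        (ofThetaSettingData μ hC hS h Q R K' constEmb constEmb_injective hinvc hinvp).BN
        (ofThetaSettingData μ hC hS h Q R K' constEmb constEmb_injective hinvc hinvp).N ≃* MuN p N) :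
    (ofThetaSettingData μ hC hS h Q R K' constEmb constEmb_injective hinvc hinvp).CyclotomicCharacterCompatX (C.thetaEnvData μ hC hS)
        (MulEquiv.refl _) m ↔
      ∀ (g : C.Huu)
        (u u' : (ofThetaSettingData μ hC hS h Q R K' constEmb constEmb_injective hinvc hinvp).muTorsion
          (ofThetaSettingData μ hC hS h Q R K' constEmb constEmb_injective hinvc hinvp).BN
          (ofThetaSettingData μ hC hS h Q R K' constEmb constEmb_injective hinvc hinvp).N),
        ModelFrobenioid.unit u'.1.hom =
            pull tf.ratFnFunctor ((ofThetaSettingData μ hC hS h Q R K' constEmb constEmb_injective hinvc hinvp).ρ g).inv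
              (ModelFrobenioid.unit u.1.hom) →
          m u' = (C.thetaEnvData μ hC hS).chi ((C.thetaEnvData μ hC hS).aug g) (m u) :=
  cyclotomicCharacterCompatX_ofConnectedTemperoidData_iff_ratFn (T := C.thetaEnvData μ hC hS) h Q C.odd_lPNat R (ContinuousMulEquiv.refl _)
    K' constEmb constEmb_injective hinvc hinvp (C.thetaEnvData μ hC hS) (MulEquiv.refl _) m

end Junction

end ThetaFrobenioid

end Literature.AnabelianGeometry.EtaleTheta

end
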